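import Mathlib.Analysis.Calculus.BumpFunction.FiniteDimension
import Mathlib.Analysis.Calculus.ContDiff.RCLike
import Mathlib.MeasureTheory.Measure.Regular
import Mathlib.MeasureTheory.Constructions.BorelSpace.Metrizable
import Literature.MathematicalPhysics.KineticTheory.NewtonianFlowLiouville
import Literature.Analysis.ODE.LipschitzFlow
import HarnessLib

/-!
# Liouville's theorem for Newtonian systems with `C¹` (unbounded, locally Lipschitz) forces

`NewtonianFlowLiouville.lean` proves that every jointly continuous flow of `q̇ = p`, `ṗ = F(q)`
preserves Lebesgue measure when `F` is **bounded and globally Lipschitz**. Here the hypothesis on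
`F` is weakened to `F ∈ C¹` (no growth condition), at the price of *assuming* global existence:
a **solution family** `Φ : ℝ → Ω → Ω` (`NewtonianFlow.IsSolutionFamily F Φ`: `Φ_0 = id` and
every `s ↦ Φ_s z` is an integral curve on all of `ℝ`; nothing is assumed about the dependence on
`z`). This is exactly the situation of Lanford–Lebowitz–Lieb 1977, §4 (condition B1: the severed
equations of motion have global solutions for all initial points; A2: the potentials are `C²`),
where Liouville's theorem for the severed flows is invoked (remark (i), p. 459) to get the
invariance of Gibbs states. [cite: LanfordLebowitzLieb1977, §4 remark (i)]

## Method (no Jacobians)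

For `n : ℕ` let `F_n = χ_n • F` with `χ_n` a smooth bump equal to `1` on the closed ball of radius
`n + 1` (`NewtonianFlow.cutoff`); `F_n` is `C¹` with compact support, hence bounded and globally
Lipschitz, and `NewtonianFlow.cutoffFlow` is its global flow (`Literature.Analysis.ODE.lipschitzFlow`,
jointly `C¹`, so `NewtonianFlow.IsFlow (cutoff n F) (cutoffFlow hF n)`).
* **Localisation** (`IsSolutionFamily.exists_forall_eq_cutoffFlow`): on a bounded time interval the
  true orbit of `z` stays in a ball, so it is an orbit of `F_n` for all large `n` (uniqueness for the
  Lipschitz field); hence `Φ_t = lim_n Φ^{(n)}_t` pointwise (eventually constant) and `Φ_t` is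
  measurable (`IsSolutionFamily.measurable`).
* **Group law** `Φ_{t+s} = Φ_t ∘ Φ_s`, `Φ_{-t} = Φ_t⁻¹` from uniqueness for the locally Lipschitz
  field (`Literature.Analysis.ODE.eqOn_Ioo_of_hasDerivAt`).
* **Convergence of the symplectic Euler scheme** for the `C¹` force
  (`IsSolutionFamily.tendsto_iterate_eulerStep`): along the orbit the scheme for `F` coincides with
  the scheme for `F_n` (all intermediate iterates stay within distance `1` of the orbit by the
  global error bound `IsFlow.norm_iterate_eulerStep_sub_le` of the bounded case), and the latter
  converges.
* **Liouville** (`IsSolutionFamily.measurePreserving`): Fatou along the volume-preserving Euler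
  iterates gives `vol(Φ_t⁻¹ U) ≤ vol U` for open `U`, outer regularity extends this to all
  measurable sets, and `Φ_{-t} = Φ_t⁻¹` gives equality. [cite: Arnold1978, §16 Thm 1]
-/

noncomputable section

open MeasureTheory Filter Topology Set Metric
open scoped ContDiff NNReal

namespace Literature.MathematicalPhysics.KineticTheory

open HeatConduction (PhaseSpace)

namespace NewtonianFlow

variable {N : ℕ}

/-- A **solution family** of `q̇ = p`, `ṗ = F(q)`: `Φ_0 = id` and every `s ↦ Φ_s z` is a global
integral curve of `X_F` (the two dynamical clauses of `NewtonianFlow.IsFlow`, without any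
continuity in the initial point). [folklore] -/
def IsSolutionFamily (F : (Fin N → ℝ) → (Fin N → ℝ)) (Φ : ℝ → PhaseSpace N → PhaseSpace N) : Prop :=
  (∀ z, Φ 0 z = z) ∧
    ∀ (z : PhaseSpace N) (t : ℝ), HasDerivAt (fun s => Φ s z) (vectorField F (Φ t z)) t

/-- A flow is a solution family. [folklore] -/
theorem IsFlow.isSolutionFamily {F : (Fin N → ℝ) → (Fin N → ℝ)}
    {Φ : ℝ → PhaseSpace N → PhaseSpace N} (hΦ : IsFlow F Φ) : IsSolutionFamily F Φ :=
  ⟨hΦ.2.1, hΦ.2.2⟩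

/-- The Newtonian vector field of a `C^n` force is `C^n`. [folklore] -/
theorem contDiff_vectorField {F : (Fin N → ℝ) → (Fin N → ℝ)} {n : ℕ∞} (hF : ContDiff ℝ n F) :
    ContDiff ℝ n (vectorField F) := by
  change ContDiff ℝ n (fun z : PhaseSpace N => ((z.2, F z.1) : PhaseSpace N))
  exact contDiff_snd.prodMk (hF.comp contDiff_fst)

/-- The Newtonian vector field of a `C¹` force is locally Lipschitz. [folklore] -/
theorem locallyLipschitzOn_vectorField {F : (Fin N → ℝ) → (Fin N → ℝ)} (hF : ContDiff ℝ 1 F) :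
    LocallyLipschitzOn univ (vectorField F) :=
  ((contDiff_vectorField hF).locallyLipschitz).locallyLipschitzOn

namespace IsSolutionFamily

variable {F : (Fin N → ℝ) → (Fin N → ℝ)} {Φ : ℝ → PhaseSpace N → PhaseSpace N}

/-- `Φ_0 = id`. [folklore] -/
theorem apply_zero (hΦ : IsSolutionFamily F Φ) (z : PhaseSpace N) : Φ 0 z = z := hΦ.1 z

/-- Flow curves are integral curves. [folklore] -/
theorem hasDerivAt (hΦ : IsSolutionFamily F Φ) (z : PhaseSpace N) (t : ℝ) :
    HasDerivAt (fun s => Φ s z) (vectorField F (Φ t z)) t := hΦ.2 z t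

/-- Flow curves are continuous. [folklore] -/
theorem continuous_curve (hΦ : IsSolutionFamily F Φ) (z : PhaseSpace N) :
    Continuous fun s => Φ s z :=
  continuous_iff_continuousAt.2 fun t => (hΦ.hasDerivAt z t).continuousAt

/-- The position component of a flow curve has derivative `p`. [folklore] -/
theorem hasDerivAt_fst (hΦ : IsSolutionFamily F Φ) (z : PhaseSpace N) (t : ℝ) :
    HasDerivAt (fun s => (Φ s z).1) ((Φ t z).2) t :=
  ((ContinuousLinearMap.fst ℝ (Fin N → ℝ) (Fin N → ℝ)).hasFDerivAt).comp_hasDerivAt t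
    (hΦ.hasDerivAt z t)

/-- The momentum component of a flow curve has derivative `F(q)`. [folklore] -/
theorem hasDerivAt_snd (hΦ : IsSolutionFamily F Φ) (z : PhaseSpace N) (t : ℝ) :
    HasDerivAt (fun s => (Φ s z).2) (F (Φ t z).1) t :=
  ((ContinuousLinearMap.snd ℝ (Fin N → ℝ) (Fin N → ℝ)).hasFDerivAt).comp_hasDerivAt t
    (hΦ.hasDerivAt z t)

/-- **Uniqueness** for `C¹` forces: every global integral curve of `X_F` is a flow curve.
[folklore] -/
theorem eq_apply (hΦ : IsSolutionFamily F Φ) (hF : ContDiff ℝ 1 F) {γ : ℝ → PhaseSpace N}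
    (hγ : ∀ t, HasDerivAt γ (vectorField F (γ t)) t) (t : ℝ) : γ t = Φ t (γ 0) := by
  have ht : t ∈ Ioo (-(|t| + 1)) (|t| + 1) := by
    constructor <;> cases abs_cases t <;> linarith
  have h0 : (0 : ℝ) ∈ Ioo (-(|t| + 1)) (|t| + 1) := by
    constructor <;> linarith [abs_nonneg t]
  exact Literature.Analysis.ODE.eqOn_Ioo_of_hasDerivAt isOpen_univ (locallyLipschitzOn_vectorField hF) h0
    (fun s _ => hγ s) (fun _ _ => mem_univ _) (fun s _ => hΦ.hasDerivAt (γ 0) s)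
    (by rw [hΦ.apply_zero]) ht

/-- **Group law** `Φ_{t+s} = Φ_t ∘ Φ_s` for `C¹` forces. [folklore] -/
theorem add_apply (hΦ : IsSolutionFamily F Φ) (hF : ContDiff ℝ 1 F) (t s : ℝ) (z : PhaseSpace N) :
    Φ (t + s) z = Φ t (Φ s z) := by
  have h := hΦ.eq_apply hF (γ := fun u => Φ (u + s) z)
    (fun u => by
      have := (hΦ.hasDerivAt z (u + s)).comp_add_const u s
      simpa using this) t
  simpa [hΦ.apply_zero] using h

/-- `Φ_{-t} ∘ Φ_t = id`. [folklore] -/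
theorem neg_apply_apply (hΦ : IsSolutionFamily F Φ) (hF : ContDiff ℝ 1 F) (t : ℝ)
    (z : PhaseSpace N) : Φ (-t) (Φ t z) = z := by
  rw [← hΦ.add_apply hF, neg_add_cancel, hΦ.apply_zero]

/-- `Φ_t ∘ Φ_{-t} = id`. [folklore] -/
theorem apply_neg_apply (hΦ : IsSolutionFamily F Φ) (hF : ContDiff ℝ 1 F) (t : ℝ)
    (z : PhaseSpace N) : Φ t (Φ (-t) z) = z := by
  rw [← hΦ.add_apply hF, add_neg_cancel, hΦ.apply_zero]

/-- `Φ_t` is injective. [folklore] -/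
theorem injective (hΦ : IsSolutionFamily F Φ) (hF : ContDiff ℝ 1 F) (t : ℝ) :
    Function.Injective (Φ t) := fun z w h => by
  rw [← hΦ.neg_apply_apply hF t z, h, hΦ.neg_apply_apply hF t w]

/-- `Φ_t` is surjective. [folklore] -/
theorem surjective (hΦ : IsSolutionFamily F Φ) (hF : ContDiff ℝ 1 F) (t : ℝ) :
    Function.Surjective (Φ t) := fun w => ⟨Φ (-t) w, hΦ.apply_neg_apply hF t w⟩

/-- **A priori bound along one orbit**: positions and momenta are bounded on bounded time
intervals. [folklore] -/
theorem exists_bound_orbit (hΦ : IsSolutionFamily F Φ) (z : PhaseSpace N) (T : ℝ) :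
    ∃ R : ℝ, 0 ≤ R ∧ ∀ s ∈ Icc (-T) T, ‖(Φ s z).1‖ ≤ R ∧ ‖(Φ s z).2‖ ≤ R := by
  obtain ⟨C, hC⟩ := (isCompact_Icc (a := -T) (b := T)).exists_bound_of_continuousOn
    (hΦ.continuous_curve z).continuousOn
  refine ⟨max C 0, le_max_right _ _, fun s hs => ⟨?_, ?_⟩⟩
  · exact ((norm_fst_le _).trans (hC s hs)).trans (le_max_left _ _)
  · exact ((norm_snd_le _).trans (hC s hs)).trans (le_max_left _ _)

end IsSolutionFamily

/-! ### Smooth cutoffs of the force -/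

/-- A smooth bump on position space, equal to `1` on the closed ball of radius `n + 1` and
supported in the ball of radius `n + 2`. [folklore] -/
def bump (N n : ℕ) : ContDiffBump (0 : Fin N → ℝ) :=
  ⟨n + 1, n + 2, by positivity, by linarith⟩

/-- The cut-off force `F_n = χ_n • F`. [folklore] -/
def cutoff (n : ℕ) (F : (Fin N → ℝ) → (Fin N → ℝ)) : (Fin N → ℝ) → (Fin N → ℝ) :=
  fun q => (bump N n) q • F q

/-- `F_n = F` on the closed ball of radius `n + 1`. [folklore] -/
theorem cutoff_eq_of_norm_le {n : ℕ} (F : (Fin N → ℝ) → (Fin N → ℝ)) {q : Fin N → ℝ}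
    (hq : ‖q‖ ≤ n + 1) : cutoff n F q = F q := by
  have h1 : (bump N n) q = 1 := by
    apply ContDiffBump.one_of_mem_closedBall
    rw [mem_closedBall, dist_zero_right]
    exact hq
  simp [cutoff, h1]

/-- The cut-off force is `C^k` if `F` is. [folklore] -/
theorem contDiff_cutoff {n : ℕ} {F : (Fin N → ℝ) → (Fin N → ℝ)} {k : ℕ∞} (hF : ContDiff ℝ k F) :
    ContDiff ℝ k (cutoff n F) :=
  ((bump N n).contDiff (n := k)).smul hF

/-- The cut-off force has compact support. [folklore] -/
theorem hasCompactSupport_cutoff (n : ℕ) (F : (Fin N → ℝ) → (Fin N → ℝ)) :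
    HasCompactSupport (cutoff n F) := by
  have h : HasCompactSupport (bump N n : (Fin N → ℝ) → ℝ) := (bump N n).hasCompactSupport
  exact h.smul_right

/-- The cut-off force is continuous. [folklore] -/
theorem continuous_cutoff {n : ℕ} {F : (Fin N → ℝ) → (Fin N → ℝ)} (hF : ContDiff ℝ 1 F) :
    Continuous (cutoff n F) :=
  (contDiff_cutoff hF).continuous

/-- The cut-off force is globally Lipschitz. [folklore] -/
theorem exists_lipschitzWith_cutoff {F : (Fin N → ℝ) → (Fin N → ℝ)} (hF : ContDiff ℝ 1 F)
    (n : ℕ) : ∃ K : ℝ≥0, LipschitzWith K (cutoff n F) :=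
  (contDiff_cutoff hF).lipschitzWith_of_hasCompactSupport (hasCompactSupport_cutoff n F)
    (by simp)

/-- The cut-off force is bounded. [folklore] -/
theorem exists_bound_cutoff {F : (Fin N → ℝ) → (Fin N → ℝ)} (hF : ContDiff ℝ 1 F) (n : ℕ) :
    ∃ M : ℝ, ∀ q, ‖cutoff n F q‖ ≤ M :=
  (continuous_cutoff hF).bounded_above_of_compact_support (hasCompactSupport_cutoff n F)

/-- A Lipschitz constant of the cut-off force (by choice). [folklore] -/
def cutoffLipschitz {F : (Fin N → ℝ) → (Fin N → ℝ)} (hF : ContDiff ℝ 1 F) (n : ℕ) : ℝ≥0 :=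
  (exists_lipschitzWith_cutoff hF n).choose

/-- The chosen Lipschitz constant works. [folklore] -/
theorem lipschitzWith_cutoff {F : (Fin N → ℝ) → (Fin N → ℝ)} (hF : ContDiff ℝ 1 F) (n : ℕ) :
    LipschitzWith (cutoffLipschitz hF n) (cutoff n F) :=
  (exists_lipschitzWith_cutoff hF n).choose_spec

/-- The **global flow of the cut-off system** `q̇ = p`, `ṗ = F_n(q)` (the Lipschitz flow of
`Literature.Analysis.ODE.lipschitzFlow`, arguments in the order time, point). [folklore] -/
def cutoffFlow {F : (Fin N → ℝ) → (Fin N → ℝ)} (hF : ContDiff ℝ 1 F) (n : ℕ) :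
    ℝ → PhaseSpace N → PhaseSpace N :=
  fun t z => Literature.Analysis.ODE.lipschitzFlow
    (lipschitzWith_vectorField (lipschitzWith_cutoff hF n)) z t

/-- The cut-off flow is a flow in the sense of `NewtonianFlow.IsFlow` (jointly continuous, being
jointly `C¹` by `contDiff_lipschitzFlow`). [folklore] -/
theorem isFlow_cutoffFlow {F : (Fin N → ℝ) → (Fin N → ℝ)} (hF : ContDiff ℝ 1 F) (n : ℕ) :
    IsFlow (cutoff n F) (cutoffFlow hF n) := by
  have hK := lipschitzWith_vectorField (lipschitzWith_cutoff hF n)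
  have hsmooth : ContDiff ℝ 1 fun p : PhaseSpace N × ℝ =>
      Literature.Analysis.ODE.lipschitzFlow hK p.1 p.2 :=
    Literature.Analysis.ODE.contDiff_lipschitzFlow (n := 1)
      (contDiff_vectorField (contDiff_cutoff hF)) le_rfl hK
  refine ⟨?_, fun z => Literature.Analysis.ODE.lipschitzFlow_zero hK z, fun z t =>
    Literature.Analysis.ODE.hasDerivAt_lipschitzFlow hK z t⟩
  exact hsmooth.continuous.comp continuous_swap

namespace IsSolutionFamily

variable {F : (Fin N → ℝ) → (Fin N → ℝ)} {Φ : ℝ → PhaseSpace N → PhaseSpace N}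

/-- **Localisation**: on a bounded time interval, the orbit of `z` is the orbit of the cut-off
flow for every large cut-off radius. [folklore] -/
theorem exists_forall_eq_cutoffFlow (hΦ : IsSolutionFamily F Φ) (hF : ContDiff ℝ 1 F)
    (z : PhaseSpace N) (T : ℝ) :
    ∃ n₀ : ℕ, ∀ n : ℕ, n₀ ≤ n → ∀ s ∈ Icc (-T) T, Φ s z = cutoffFlow hF n s z := by
  obtain ⟨R, hR0, hR⟩ := hΦ.exists_bound_orbit z (|T| + 1)
  refine ⟨⌈R⌉₊, fun n hn s hs => ?_⟩
  have hRn : R ≤ n + 1 := ((Nat.le_ceil R).trans (by exact_mod_cast hn)).trans (le_add_of_nonneg_right zero_le_one)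
  have hK := lipschitzWith_vectorField (lipschitzWith_cutoff hF n)
  have h0 : (0 : ℝ) ∈ Ioo (-(|T| + 1)) (|T| + 1) := by constructor <;> linarith [abs_nonneg T]
  have hcurve : ∀ u ∈ Ioo (-(|T| + 1)) (|T| + 1),
      HasDerivAt (fun s => Φ s z) (vectorField (cutoff n F) (Φ u z)) u := by
    intro u hu
    have hq : ‖(Φ u z).1‖ ≤ n + 1 := ((hR u ⟨hu.1.le, hu.2.le⟩).1).trans hRn
    have e : vectorField (cutoff n F) (Φ u z) = vectorField F (Φ u z) := by
      ext1
      · rfl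
      · exact cutoff_eq_of_norm_le F hq
    rw [e]
    exact hΦ.hasDerivAt z u
  have hs' : s ∈ Ioo (-(|T| + 1)) (|T| + 1) := by
    constructor
    · have := hs.1; cases abs_cases T <;> linarith
    · have := hs.2; cases abs_cases T <;> linarith
  have h := Literature.Analysis.ODE.eqOn_lipschitzFlow hK h0 hcurve hs'
  simpa [cutoffFlow, hΦ.apply_zero] using h

/-- The flow maps of a solution family with `C¹` force are **measurable** (pointwise limits of
the continuous cut-off flow maps). [folklore] -/
theorem measurable (hΦ : IsSolutionFamily F Φ) (hF : ContDiff ℝ 1 F) (t : ℝ) :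
    Measurable (Φ t) := by
  refine measurable_of_tendsto_metrizable (f := fun n : ℕ => cutoffFlow hF n t)
    (fun n => ((isFlow_cutoffFlow hF n).continuous_apply t).measurable) ?_
  rw [tendsto_pi_nhds]
  intro z
  obtain ⟨n₀, hn₀⟩ := hΦ.exists_forall_eq_cutoffFlow hF z |t|
  have ht : t ∈ Icc (-|t|) |t| := ⟨neg_abs_le t, le_abs_self t⟩
  exact tendsto_atTop_of_eventually_const (i₀ := n₀) fun n hn => (hn₀ n hn t ht).symm

/-- **Intermediate iterates of the symplectic Euler scheme stay close to the orbit** (bounded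
Lipschitz force): with `m` steps of size `t/m`, for every `j ≤ m`,
`‖S_{t/m}^j z - Φ_{jt/m} z‖ ≤ C(z, t)/m`. [folklore] -/
theorem _root_.Literature.MathematicalPhysics.KineticTheory.NewtonianFlow.IsFlow.norm_iterate_eulerStep_sub_le_of_le
    {G : (Fin N → ℝ) → (Fin N → ℝ)} {Ψ : ℝ → PhaseSpace N → PhaseSpace N} (hΨ : IsFlow G Ψ)
    {K : ℝ≥0} (hG : LipschitzWith K G) {M : ℝ} (hM : ∀ q, ‖G q‖ ≤ M) (t : ℝ) (z : PhaseSpace N)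
    {m : ℕ} (hm : 0 < m) {j : ℕ} (hj : j ≤ m) :
    ‖(eulerStep G (t / m))^[j] z - Ψ (j * (t / m)) z‖ ≤
      ((M + K * M * |t| + K * (‖z.2‖ + M * |t|)) * t ^ 2 *
        Real.exp (|t| * K + |t| + t ^ 2 * K)) / m := by
  have hM0 : 0 ≤ M := (norm_nonneg _).trans (hM 0)
  have hK0 : (0 : ℝ) ≤ K := K.2
  have hm0 : (0 : ℝ) < m := by exact_mod_cast hm
  rcases Nat.eq_zero_or_pos j with rfl | hj0
  · simp only [Function.iterate_zero, id_eq, Nat.cast_zero, zero_mul, hΨ.2.1, sub_self, norm_zero]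
    positivity
  have hj0' : (0 : ℝ) < j := by exact_mod_cast hj0
  set t' : ℝ := j * (t / m) with ht'
  have hstep : t' / j = t / m := by rw [ht']; field_simp
  have habs : |t'| ≤ |t| := by
    rw [ht', abs_mul, Nat.abs_cast]
    have hjm : (j : ℝ) ≤ m := by exact_mod_cast hj
    calc (j : ℝ) * |t / m| = j * (|t| / m) := by rw [abs_div, Nat.abs_cast]
      _ ≤ m * (|t| / m) := mul_le_mul_of_nonneg_right hjm (by positivity)
      _ = |t| := by field_simp
  have h := hΨ.norm_iterate_eulerStep_sub_le hG hM t' z hj0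
  rw [hstep] at h
  refine h.trans ?_
  -- compare the constants
  have hsq : t' ^ 2 / j ≤ t ^ 2 / m := by
    rw [ht']
    have hjm : (j : ℝ) ≤ m := by exact_mod_cast hj
    have e : ((j : ℝ) * (t / m)) ^ 2 / j = j * t ^ 2 / m ^ 2 := by
      field_simp
    rw [e, div_le_div_iff₀ (by positivity) hm0]
    calc (j : ℝ) * t ^ 2 * m ≤ m * t ^ 2 * m := by gcongr
      _ = t ^ 2 * m ^ 2 := by ring
  have hA : M + K * M * |t'| + K * (‖z.2‖ + M * |t'|) ≤ M + K * M * |t| + K * (‖z.2‖ + M * |t|) := by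
    gcongr
  have hE : Real.exp (|t'| * K + |t'| + t' ^ 2 * K) ≤ Real.exp (|t| * K + |t| + t ^ 2 * K) := by
    apply Real.exp_le_exp.2
    have : t' ^ 2 ≤ t ^ 2 := by
      rw [← sq_abs, ← sq_abs t]; exact pow_le_pow_left₀ (abs_nonneg _) habs 2
    gcongr
  have hApos : 0 ≤ M + K * M * |t| + K * (‖z.2‖ + M * |t|) := by positivity
  calc (M + K * M * |t'| + K * (‖z.2‖ + M * |t'|)) * t' ^ 2 *
        Real.exp (|t'| * K + |t'| + t' ^ 2 * K) / j
      = (M + K * M * |t'| + K * (‖z.2‖ + M * |t'|)) *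
          Real.exp (|t'| * K + |t'| + t' ^ 2 * K) * (t' ^ 2 / j) := by ring
    _ ≤ (M + K * M * |t| + K * (‖z.2‖ + M * |t|)) *
          Real.exp (|t| * K + |t| + t ^ 2 * K) * (t ^ 2 / m) := by
        gcongr
    _ = (M + K * M * |t| + K * (‖z.2‖ + M * |t|)) * t ^ 2 *
          Real.exp (|t| * K + |t| + t ^ 2 * K) / m := by ring

/-- **Convergence of the symplectic Euler scheme for a `C¹` force**: for every `z` and `t`,
`S_{t/k}^k(z) → Φ_t(z)` (`S_h = ` `NewtonianFlow.eulerStep F h`). Along the orbit the scheme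
for `F` coincides, for large `k`, with the scheme for a cut-off force, which converges by the
bounded case. [folklore] -/
theorem tendsto_iterate_eulerStep (hΦ : IsSolutionFamily F Φ) (hF : ContDiff ℝ 1 F) (t : ℝ)
    (z : PhaseSpace N) :
    Tendsto (fun k : ℕ => (eulerStep F (t / (k + 1 : ℕ)))^[k + 1] z) atTop (𝓝 (Φ t z)) := by
  -- bounds along the orbit on `[-|t|, |t|]`
  obtain ⟨R, hR0, hR⟩ := hΦ.exists_bound_orbit z |t|
  -- localisation
  obtain ⟨n₀, hn₀⟩ := hΦ.exists_forall_eq_cutoffFlow hF z |t|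
  set n : ℕ := max n₀ ⌈R + 1 + |t| * (R + 1)⌉₊ with hn
  have hn₀n : n₀ ≤ n := le_max_left _ _
  have hRn : R + 1 + |t| * (R + 1) ≤ n + 1 := by
    have h1 : R + 1 + |t| * (R + 1) ≤ ⌈R + 1 + |t| * (R + 1)⌉₊ := Nat.le_ceil _
    have h2 : (⌈R + 1 + |t| * (R + 1)⌉₊ : ℝ) ≤ n := by rw [hn]; exact_mod_cast le_max_right _ _
    linarith
  set G := cutoff n F with hG
  set Ψ := cutoffFlow hF n with hΨ
  have hΨflow : IsFlow G Ψ := isFlow_cutoffFlow hF n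
  have hGK : LipschitzWith (cutoffLipschitz hF n) G := lipschitzWith_cutoff hF n
  obtain ⟨M, hM⟩ := exists_bound_cutoff hF n
  set K : ℝ≥0 := cutoffLipschitz hF n
  -- the orbit coincides with the cut-off orbit on `[-|t|, |t|]`
  have horbit : ∀ s ∈ Icc (-|t|) |t|, Φ s z = Ψ s z := fun s hs => hn₀ n hn₀n s hs
  -- global error constant of the cut-off scheme
  set C : ℝ := (M + K * M * |t| + K * (‖z.2‖ + M * |t|)) * t ^ 2 *
    Real.exp (|t| * K + |t| + t ^ 2 * K) with hC
  -- for large `k`, the error is `≤ 1`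
  obtain ⟨k₀, hk₀⟩ : ∃ k₀ : ℕ, ∀ k : ℕ, k₀ ≤ k → C / ((k + 1 : ℕ) : ℝ) ≤ 1 := by
    obtain ⟨k₀, hk₀⟩ := exists_nat_ge C
    refine ⟨k₀, fun k hk => ?_⟩
    rw [div_le_one (by positivity)]
    calc C ≤ k₀ := hk₀
      _ ≤ ((k + 1 : ℕ) : ℝ) := by exact_mod_cast hk.trans (Nat.le_succ k)
  -- the two schemes agree for `k ≥ k₀`
  have hagree : ∀ k : ℕ, k₀ ≤ k → ∀ j ≤ k + 1,
      (eulerStep F (t / (k + 1 : ℕ)))^[j] z = (eulerStep G (t / (k + 1 : ℕ)))^[j] z := by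
    intro k hk j hj
    induction j with
    | zero => rfl
    | succ j ih =>
      have hjk : j ≤ k + 1 := Nat.le_of_succ_le hj
      rw [Function.iterate_succ_apply', Function.iterate_succ_apply', ih hjk]
      set y := (eulerStep G (t / (k + 1 : ℕ)))^[j] z with hy
      set h : ℝ := t / (k + 1 : ℕ) with hh
      -- `y` is within distance 1 of the orbit point `w = Ψ (j h) z = Φ (j h) z`
      have herr : ‖y - Ψ (j * h) z‖ ≤ 1 :=
        (hΨflow.norm_iterate_eulerStep_sub_le_of_le hGK hM t z (Nat.succ_pos k) hjk).trans
          (hk₀ k hk)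
      have hjh : (j : ℝ) * h ∈ Icc (-|t|) |t| := by
        have habs : |(j : ℝ) * h| ≤ |t| := by
          rw [hh, abs_mul, Nat.abs_cast, abs_div, Nat.abs_cast]
          have hjm : (j : ℝ) ≤ (k + 1 : ℕ) := by exact_mod_cast hjk
          have hpos : (0 : ℝ) < (k + 1 : ℕ) := by positivity
          calc (j : ℝ) * (|t| / (k + 1 : ℕ)) ≤ (k + 1 : ℕ) * (|t| / (k + 1 : ℕ)) :=
                mul_le_mul_of_nonneg_right hjm (by positivity)
            _ = |t| := by field_simp
        exact abs_le.mp habs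
      have hw := hR (j * h) hjh
      rw [horbit _ hjh] at hw
      have habsh : |h| ≤ |t| := by
        rw [hh, abs_div, Nat.abs_cast]
        exact div_le_self (abs_nonneg t) (by exact_mod_cast Nat.succ_le_succ (Nat.zero_le k))
      -- hence the drifted position is in the ball where `G = F`
      have hq : ‖y.1 + h • y.2‖ ≤ n + 1 := by
        have e : y.1 + h • y.2 = (Ψ (j * h) z).1 + (y - Ψ (j * h) z).1 +
            h • ((Ψ (j * h) z).2 + (y - Ψ (j * h) z).2) := by
          simp only [Prod.fst_sub, Prod.snd_sub, smul_add, smul_sub]; abel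
        rw [e]
        have h1 : ‖(y - Ψ (j * h) z).1‖ ≤ 1 := (norm_fst_le _).trans herr
        have h2 : ‖(y - Ψ (j * h) z).2‖ ≤ 1 := (norm_snd_le _).trans herr
        calc ‖(Ψ (j * h) z).1 + (y - Ψ (j * h) z).1 + h • ((Ψ (j * h) z).2 + (y - Ψ (j * h) z).2)‖
            ≤ ‖(Ψ (j * h) z).1‖ + ‖(y - Ψ (j * h) z).1‖ +
                |h| * (‖(Ψ (j * h) z).2‖ + ‖(y - Ψ (j * h) z).2‖) := by
              refine (norm_add_le _ _).trans (add_le_add (norm_add_le _ _) ?_)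
              rw [norm_smul, Real.norm_eq_abs]
              exact mul_le_mul_of_nonneg_left (norm_add_le _ _) (abs_nonneg h)
          _ ≤ R + 1 + |t| * (R + 1) := by
              gcongr
              · exact hw.1
              · exact hw.2
          _ ≤ n + 1 := hRn
      change kick F h (drift h y) = kick G h (drift h y)
      simp only [kick, drift, hG, cutoff_eq_of_norm_le F hq]
  -- conclude from the convergence of the cut-off scheme
  have hlim : Tendsto (fun k : ℕ => (eulerStep G (t / (k + 1 : ℕ)))^[k + 1] z) atTop (𝓝 (Ψ t z)) :=
    hΨflow.tendsto_iterate_eulerStep hGK hM t z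
  have ht : t ∈ Icc (-|t|) |t| := ⟨neg_abs_le t, le_abs_self t⟩
  rw [horbit t ht]
  refine hlim.congr' ?_
  filter_upwards [eventually_ge_atTop k₀] with k hk
  exact (hagree k hk (k + 1) le_rfl).symm

/-- **Fatou step of Liouville's theorem** for a `C¹` force: `vol(Φ_t⁻¹ U) ≤ vol U` for open `U`.
[folklore] -/
theorem volume_preimage_le_of_isOpen (hΦ : IsSolutionFamily F Φ) (hF : ContDiff ℝ 1 F) (t : ℝ)
    {U : Set (PhaseSpace N)} (hU : IsOpen U) : volume (Φ t ⁻¹' U) ≤ volume U := by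
  set Ψ : ℕ → PhaseSpace N → PhaseSpace N := fun k => (eulerStep F (t / (k + 1 : ℕ)))^[k + 1]
    with hΨ
  have hFc : Continuous F := hF.continuous
  have hΨc : ∀ k, Continuous (Ψ k) := fun k => (continuous_eulerStep hFc _).iterate _
  have hΨm : ∀ k, MeasurePreserving (Ψ k) volume volume := fun k =>
    (measurePreserving_eulerStep hFc.measurable _).iterate _
  have hconv : ∀ z, Tendsto (fun k => Ψ k z) atTop (𝓝 (Φ t z)) := fun z =>
    hΦ.tendsto_iterate_eulerStep hF t z
  have hmU : MeasurableSet U := hU.measurableSet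
  have hle : ∀ z, (Φ t ⁻¹' U).indicator (1 : PhaseSpace N → ENNReal) z ≤
      liminf (fun k => ((Ψ k) ⁻¹' U).indicator (1 : PhaseSpace N → ENNReal) z) atTop := by
    intro z
    by_cases hz : Φ t z ∈ U
    · have hev : ∀ᶠ k in atTop, Ψ k z ∈ U := (hconv z) (hU.mem_nhds hz)
      refine le_liminf_of_le (f := (atTop : Filter ℕ))
        (u := fun k => ((Ψ k) ⁻¹' U).indicator (1 : PhaseSpace N → ENNReal) z) (by isBoundedDefault) ?_
      filter_upwards [hev] with k hk
      have hk' : z ∈ (Ψ k) ⁻¹' U := hk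
      have hz' : z ∈ Φ t ⁻¹' U := hz
      rw [Set.indicator_of_mem hk', Set.indicator_of_mem hz']
    · have hz' : z ∉ Φ t ⁻¹' U := hz
      rw [Set.indicator_of_notMem hz']
      exact bot_le
  calc volume (Φ t ⁻¹' U)
      = ∫⁻ z, (Φ t ⁻¹' U).indicator 1 z := (lintegral_indicator_one
          (hmU.preimage (hΦ.measurable hF t))).symm
    _ ≤ ∫⁻ z, liminf (fun k => ((Ψ k) ⁻¹' U).indicator (1 : PhaseSpace N → ENNReal) z) atTop :=
          lintegral_mono hle
    _ ≤ liminf (fun k => ∫⁻ z, ((Ψ k) ⁻¹' U).indicator (1 : PhaseSpace N → ENNReal) z) atTop :=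
          lintegral_liminf_le fun k => (measurable_one.indicator (hmU.preimage (hΨc k).measurable))
    _ = liminf (fun _ : ℕ => volume U) atTop := by
          refine congrArg (fun f : ℕ → ENNReal => liminf f atTop) (funext fun k => ?_)
          rw [lintegral_indicator_one (hmU.preimage (hΨc k).measurable), (hΨm k).measure_preimage
            hmU.nullMeasurableSet]
    _ = volume U := liminf_const _

/-- `vol(Φ_t⁻¹ A) ≤ vol A` for every set `A` (outer regularity of Lebesgue measure). [folklore] -/
theorem volume_preimage_le (hΦ : IsSolutionFamily F Φ) (hF : ContDiff ℝ 1 F) (t : ℝ)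
    (A : Set (PhaseSpace N)) : volume (Φ t ⁻¹' A) ≤ volume A := by
  rw [A.measure_eq_iInf_isOpen volume]
  refine le_iInf₂ fun U hAU => le_iInf fun hU => ?_
  exact (measure_mono (preimage_mono hAU)).trans (hΦ.volume_preimage_le_of_isOpen hF t hU)

/-- **Liouville's theorem for `C¹` forces with global solutions**: every map `Φ_t` of a solution
family of `q̇ = p`, `ṗ = F(q)`, `F ∈ C¹`, preserves Lebesgue measure on phase space (used for the
severed flows of Lanford–Lebowitz–Lieb 1977, §4 remark (i)). [cite: Arnold1978, §16 Thm 1] -/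
theorem measurePreserving (hΦ : IsSolutionFamily F Φ) (hF : ContDiff ℝ 1 F) (t : ℝ) :
    MeasurePreserving (Φ t) volume volume := by
  refine ⟨hΦ.measurable hF t, Measure.ext fun A hA => ?_⟩
  rw [Measure.map_apply (hΦ.measurable hF t) hA]
  refine le_antisymm (hΦ.volume_preimage_le hF t A) ?_
  have h := hΦ.volume_preimage_le hF (-t) (Φ t ⁻¹' A)
  have e : Φ (-t) ⁻¹' (Φ t ⁻¹' A) = A := by
    ext z
    simp [hΦ.apply_neg_apply hF]
  rwa [e] at h

end IsSolutionFamily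

end NewtonianFlow

end Literature.MathematicalPhysics.KineticTheory

end
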